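import Mathlib
import HarnessLib
import Literature.Analysis.FluidPDE.Tao2016AveragedNS.TaylorChainCertificate
import Summits.NavierStokesRegularity.NavierStokesRegularity.Theorems.TaylorModelRungThreeReadoutFlowVar
import Summits.NavierStokesRegularity.NavierStokesRegularity.Theorems.TaylorModelRungThreeGDefs

/-!
# Line `taylor-model` on crux K1b-DR (stmt-NavierStokesRegularity-23954) — bridge from the v4.1 interface
# `IsWindowFlow` to the flow package `IsFlowPackage`

Skeleton v4.1 (`42b6425f90a56974`, line owner ns-idea-2 g3) states the G-stubs over
`IsWindowFlow cd φ := ∀ j ≤ N₀, ∃ Φ, WindowPack cd j Φ ∧ φ j = liftFlow cd Φ` (module `…TaylorModelRungThreeGDefs`).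
This file proves `isFlowPackage_of_isWindowFlow : cd.Valid → IsWindowFlow cd φ → IsFlowPackage cd φ` by assembling
the landed F-lemmas of `…ReadoutFlow` / `…ReadoutFlowVar` (exactly the proof of `stub_flow`, for a GIVEN `φ`), so that
every G-lemma written against the package clauses F0–F5 (e.g. `…ReadoutChainTools`, `…ReadoutChainStep`) applies under
the v4.1 hypothesis; plus the congruence lemmas `solvesOn_congr_flow`, `stAt_congr_flow` (the package clauses only see
`φ j`).

MODEL-lattice bookkeeping only (rung TL-M3); nothing here is a statement about the Navier–Stokes equations.
-/

noncomputable section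

-- the sub-problem namespace repeats the summit name by design (D-0017)
set_option linter.dupNamespace false

namespace Summit.NavierStokesRegularity.NavierStokesRegularity.Theorems.TaylorModelReadout

open scoped BigOperators
open Set Finset Literature.Analysis.FluidPDE.TaoCascade Literature.Analysis.FluidPDE.TaoCascade.TaylorChain
open Summit.NavierStokesRegularity.NavierStokesRegularity.Theorems.TaylorModel

variable {cd : CertData}

/-- `SolvesOn` only sees the stage component `φ j`. [folklore] -/
theorem solvesOn_congr_flow {φ ψ : Flow} {j : ℕ} (h : φ j = ψ j) (z : Fin 4 → ℤ → ℝ) (T : ℝ) :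
    SolvesOn cd φ j z T ↔ SolvesOn cd ψ j z T := by
  unfold SolvesOn; rw [h]

/-- `stAt` only sees the stage component `φ j`. [folklore] -/
theorem stAt_congr_flow {φ ψ : Flow} {j : ℕ} (h : φ j = ψ j) (z : Fin 4 → ℤ → ℝ) (t : ℝ) :
    stAt φ j z t = stAt ψ j z t := by
  unfold stAt; rw [h]

/-- **Bridge v4.1 → v4.** A window flow (per stage: S1's conclusions `WindowPack` for some window flow `Φ`, and
`φ j = liftFlow cd Φ`) of a valid certificate is a flow package (clauses F0–F5), by the landed F-lemmas.
[folklore; cite: BerzMakino1998, §2–3] -/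
theorem isFlowPackage_of_isWindowFlow {φ : Flow} (hV : cd.Valid) (hW : IsWindowFlow cd φ) :
    IsFlowPackage cd φ := by
  obtain ⟨-, hN, hC, -⟩ := hV
  intro j hj
  obtain ⟨Φ, hP, hφ⟩ := hW j hj
  have hω : ∀ k, 0 < cd.ω j k := (hN.1 j hj).2.2.2.2.2.2.1
  have hbb : 0 ≤ cd.bb j := (hN.2 j hj).1
  have hφ' : φ j = (fun _ : ℕ => liftFlow cd Φ) j := hφ
  refine ⟨?_, ?_, ?_, ?_, ?_, ?_⟩
  · -- (F0)
    intro z i k hk t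
    rw [hφ]; exact liftFlow_off_window z i hk t
  · -- (F1)
    intro z m T hm hz hT hg
    refine ⟨(solvesOn_congr_flow (ψ := fun _ => liftFlow cd Φ) hφ' z T).2 (solvesOn_liftFlow hP hm hz hT hg), fun t ht => ?_⟩
    rw [stAt_congr_flow (ψ := fun _ => liftFlow cd Φ) hφ' z t]
    exact inBall_stAt_liftFlow hP hm hz hT hg ht
  · -- (F2)
    intro z T ψ hT hψ i k hk1 hk2 t' ht'
    rw [hφ]
    exact liftFlow_unique hP hT hψ i k hk1 hk2 t' ht'
  · -- (F3)
    intro x v m ρ T hm hρ hx hv hT hg t ht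
    rw [stAt_congr_flow (ψ := fun _ => liftFlow cd Φ) hφ' (x + v) t, stAt_congr_flow (ψ := fun _ => liftFlow cd Φ) hφ' x t]
    exact inBall_stAt_liftFlow_sub hP hbb hm hρ hx hv hT hg ht
  · -- (F4)
    intro x m ρ T hm hρ hx hT hg z z' dd hz hz' hzz i k hk1 hk2 t' ht'
    rw [hφ]
    exact liftFlow_segment_deriv hP hω hbb hm hρ hx hT hg hz hz' hzz i hk1 hk2 ht'
  · -- (F5)
    intro s hs
    obtain ⟨-, -, -, -, -, -, hA, hBs⟩ := hC j hj
    obtain ⟨-, -, a3, a4, -, a6, a7, a8, a9, -, -, -, -, -, -, -, a17, a18, a19, a20⟩ := hA s hs.le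
    obtain ⟨b1, b2, b3, -⟩ := hBs s hs
    have hρO : 0 ≤ cd.ρO j s := by linarith
    have hPj : ∀ n, n ≤ cd.pdeg → toVec cd (cd.P j s n) = taylorJet (Qw cd) (toVec cd (cd.x j s)) n :=
      toVec_table_eq_taylorJet a17 a18
    have hWj : ∀ (v : Fin 4 → ℤ → ℝ) n, n ≤ cd.pdeg →
        toVec cd (cd.Wv j s n v) = varJet (Qw cd) (toVec cd (cd.x j s)) (toVec cd v) n :=
      fun v => toVec_varTable_eq_varJet (W := fun n => cd.Wv j s n v) hPj (a19 v) (fun n hn i k => a20 n hn v i k)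
    refine ⟨?_, ?_, ?_⟩
    · intro u hu
      rw [stAt_congr_flow (ψ := fun _ => liftFlow cd Φ) hφ']
      exact liftFlow_TP_bound hP a3 a4 b1.le b2 hPj hu
    · intro v ρ' hρ' hle hv _ u hu
      rw [stAt_congr_flow (ψ := fun _ => liftFlow cd Φ) hφ', stAt_congr_flow (ψ := fun _ => liftFlow cd Φ) hφ']
      exact liftFlow_Vap_bound hP hω hbb a3 a4 b1.le b3 hWj hρ' hle hv hu
    · intro y y' dd hy hy' hyy _ u hu
      rw [stAt_congr_flow (ψ := fun _ => liftFlow cd Φ) hφ', stAt_congr_flow (ψ := fun _ => liftFlow cd Φ) hφ']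
      exact liftFlow_twoPoint_bound hP hω hbb a3 a4 hρO b1.le b3 hWj hy hy' hyy hu

end Summit.NavierStokesRegularity.NavierStokesRegularity.Theorems.TaylorModelReadout

end
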